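import Summits.QuantumFields.BalabanUV.Beta.GAN24.DirichletBoxTraceSum
import Summits.QuantumFields.BalabanUV.T4Continuum.Support.RegionGaugeFixedVector

/-!
# T⁴ programme, spine node NE2 (U1a), sub-row Δ1 «NE2⁰-Dirichlet» — THE SUMMED DISCRETE TRACE INEQUALITY ON A CARRIER THAT IS
# BLOCK-ALIGNED IN ONE DIRECTION (gan24 module M-T generalised), and its instance on the STAR carriers of the box problem

NE2 formalisation swarm `b2b-balaban-t4-ne2-formalise-*`, LEAF PROVER 03 (gen 8), item «W3-GAFFNEY-PAIRING» = (P-gaffney) for the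
LOCAL operator (owner ruling R35 (c), journal 2026-08-20 l.22128; INTENT/CLAIM l.22258), file P1 of the file plan.

WHY.  The two-level commutator pairing of the electric operator `W = curlRᴴcurlR + gradR·gradRᴴ` (O15-a's `regionDeltaLoc` minus the
mass) decomposes per component `ν` into gan24-p2-g22's FIRST-ORDER form `Σ_μ ⟨(A_μ − F_μ)ι′v, Θ_μ ∂_μ ιu⟩`; in the TRANSVERSE directions
`μ ≠ ν` it is gan24's Dirichlet case, whose boundary («exterior window») terms are controlled by the summed discrete trace inequality
`DirichletBoxTraceSum.trace_fwd_sum_le` / `trace_bwd_sum_le`.  That lemma is stated for `z` supported in a block region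
`Ω = blockReg n S`; but the carrier of component `ν` of a star-bond field is `T_ν = Ω ∪ (Ω − e_ν)` (the sites `x` with `(x, ν)` a star
bond, `RegionGaugeFixedVector.starReg`), which is NOT a union of `n`-blocks (the deficient layer is one site thick).  gan24's proof uses
the region only through four facts about the direction `μ` of the trace: a site whose backward (forward) `μ`-neighbour is outside lies
on the first (last) `μ`-layer of its block, and the whole block `μ`-line through such a site stays inside.  THIS FILE isolates these four
facts as a [shape] predicate and re-runs gan24's proof verbatim on it:

 * §1 **`AlignedDir n M μ P`** ([shape], four fields `fwd`/`line_add`/`bwd`/`line_sub`); `alignedDir_blockReg` (gan24's case back,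
   from `dvd_of_boundary_fwd` / `blockReg_add_tstep` / `dvd_succ_of_boundary_bwd` / `blockReg_sub_tstep`).
 * §2 **`trace_fwd_sum_le_of_aligned`** / **`trace_bwd_sum_le_of_aligned`**: for `z` vanishing off `P`, `P` aligned in direction `μ`,
   `Σ_{y ∈ P, y ∓ e_μ ∉ P} ‖n·z(y)‖² ≤ (2/n)·(‖∂_μz‖² + Σ_{x∈P}‖(∂_μᴴ∂_μz)(x)‖²)` — gan24's statement and proof with `blockReg n S`
   replaced by `P` (the pointwise inequalities `trace_sq_le_fwd/bwd` and the line tiling `sum_lines_le_of_subset` are torus facts, imported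
   BY NAME).
 * §3 THE STAR CARRIER: `starSite n M S ν x :↔ starReg n M S (x, ν)` (`= blockReg x ∨ blockReg (x + e_ν)`), and
   **`alignedDir_starSite (hμν : μ ≠ ν)`** — for EVERY region `S` (no box hypothesis) the star carrier of component `ν` is block-aligned
   in every transverse direction (a transverse unit step does not change the `ν`-block coordinate); hence
   **`trace_fwd_sum_le_starSite`** / **`trace_bwd_sum_le_starSite`**.  (In its own direction `ν` the carrier is NOT aligned — the deficient
   layer; there the pairing is Neumann and needs no wall trace; the deficient-layer trace is leaf-06-g6's `RegionStarTrace.trace_deficient_le`.)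

HONEST FRAMING (T4-DAG p. 1).  [folklore] finite lattice calculus on the tree's typed torus objects; nothing printed is a hypothesis or a
conclusion; no NE2 statement is proved here (bookkeeping input of (P-gaffney)); (L) / `hinjK` / W3 on boxes OPEN; NE2 (U1a) NOT proved;
spine PROVED 0/9 unchanged; NOT [B9] (3.16)/(3.23)–(3.27) as printed; NOT infinite volume, NOT a mass gap, NOT the Clay problem, NOT
summit progress.  HONEST DEPENDENCY: continuum YM on T⁴ ⇐ BetaPertH ∧ nine spine estimates (0/9 proved); BetaPertH ⇐ (D1) ∧ (D4) ∧
CAP+tail; G-an2-4 gates asym, D1 and NE2/3/4.  No `sorry`.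
-/

noncomputable section

open scoped BigOperators ComplexConjugate Matrix
open Finset

namespace Summit.QuantumFields.BalabanUV.T4Continuum.AlignedCarrierTrace

open Literature.MathematicalPhysics.QuantumFieldTheory.Balaban1983to89.B5Prop11Plancherel (Tor fine unitVec)
open Literature.MathematicalPhysics.QuantumFieldTheory.Balaban1983to89.B5Action121 (sdiff sdiff_mulVec)
open Literature.MathematicalPhysics.QuantumFieldTheory.Balaban1983to89.B5Prop11Lower (nsq nsq_nonneg)
open Literature.MathematicalPhysics.QuantumFieldTheory.Balaban1983to89.B5Block118 (tstep tstep_zero tstep_succ)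
open Summit.QuantumFields.BalabanUV.Beta.GAN24.DirichletBoxRegularity (Pdir Pdir_mulVec)
open Summit.QuantumFields.BalabanUV.Beta.GAN24.DirichletBoxTrace (blockReg trace_sq_le_fwd trace_sq_le_bwd dvd_of_boundary_fwd
  dvd_succ_of_boundary_bwd blockReg_add_tstep blockReg_sub_tstep firstLayer_of_lastLayer sum_lines_le_of_subset)
open Summit.QuantumFields.BalabanUV.T4Continuum.VectorBlockTrialForm (tstep_add)
open Summit.QuantumFields.BalabanUV.T4Continuum.RegionGaugeFixedVector (starReg)

variable {d : ℕ}

section Torus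

variable (n : ℕ) [NeZero n] (M : Fin d → ℕ) [hM : ∀ μ, NeZero (M μ)]

/-! ## §1 Carriers block-aligned in one direction -/

/-- [shape] a carrier predicate `P` on the level-`n` torus is BLOCK-ALIGNED IN DIRECTION `μ`: a `P`-site whose backward (forward)
`μ`-neighbour is outside `P` lies on the first (last) `μ`-layer of its `n`-block, and the `n` sites of the block `μ`-line through such a
site are all in `P`.  (Every union of `n`-blocks; the star carrier of a component `ν ≠ μ`.) [folklore] -/
structure AlignedDir (μ : Fin d) (P : Tor (fine n M) → Prop) : Prop where
  fwd : ∀ y, P y → ¬ P (y - unitVec (fine n M) μ) → n ∣ (y μ).val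
  line_add : ∀ y, P y → n ∣ (y μ).val → ∀ i, i < n → P (y + tstep (fine n M) μ i)
  bwd : ∀ y, P y → ¬ P (y + unitVec (fine n M) μ) → n ∣ (y μ).val + 1
  line_sub : ∀ y, P y → n ∣ (y μ).val + 1 → ∀ i, i < n → P (y - tstep (fine n M) μ i)

/-- **every block region is aligned in every direction** (gan24's four lemmas). [folklore] -/
theorem alignedDir_blockReg (S : Tor M → Prop) (μ : Fin d) : AlignedDir n M μ (blockReg n M S) where
  fwd := fun _ hy hy' => dvd_of_boundary_fwd n M S hy hy'
  line_add := fun _ hy hdvd _ hi => blockReg_add_tstep n M S hy hdvd hi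
  bwd := fun _ hy hy' => dvd_succ_of_boundary_bwd n M S hy hy'
  line_sub := fun _ hy hdvd _ hi => blockReg_sub_tstep n M S hy hdvd hi

/-! ## §2 The summed trace bounds on an aligned carrier (gan24 M-T, region abstracted) -/

section Sum

variable {n M}
variable {μ : Fin d} {P : Tor (fine n M) → Prop} [DecidablePred P]

/-- **SUMMED TRACE BOUND, forward boundary, aligned carrier**: for `z` vanishing off `P`,
`Σ_{y∈P, y−e_μ∉P} ‖n·z(y)‖² ≤ (2/n)·(‖∂_μz‖² + Σ_{x∈P}‖(∂_μᴴ∂_μz)(x)‖²)`. [folklore] -/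
theorem trace_fwd_sum_le_of_aligned (hP : AlignedDir n M μ P) (z : Tor (fine n M) → ℂ) (hz : ∀ x, ¬ P x → z x = 0) :
    ∑ y ∈ univ.filter (fun y : Tor (fine n M) => P y ∧ ¬ P (y - unitVec (fine n M) μ)), ‖(n : ℂ) * z y‖ ^ 2
      ≤ (2 / (n : ℝ)) * (nsq (sdiff (fine n M) (n : ℂ) μ *ᵥ z)
          + ∑ x ∈ univ.filter P, ‖(Pdir (fine n M) (n : ℂ) μ *ᵥ z) x‖ ^ 2) := by
  have hn1 : 1 ≤ n := Nat.pos_of_ne_zero (NeZero.ne n)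
  have hnR : (0 : ℝ) < n := by exact_mod_cast hn1
  set D := sdiff (fine n M) (n : ℂ) μ with hD
  set Pd := Pdir (fine n M) (n : ℂ) μ with hPd
  -- the density `H = |∂z(· − e)|² + 𝟙_P |Pz|²`
  set G : Tor (fine n M) → ℝ := fun x => if P x then ‖(Pd *ᵥ z) x‖ ^ 2 else 0 with hG
  have hG0 : ∀ x, 0 ≤ G x := fun x => by simp only [hG]; split_ifs <;> positivity
  set H : Tor (fine n M) → ℝ := fun x => ‖(D *ᵥ z) (x - unitVec (fine n M) μ)‖ ^ 2 + G x with hH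
  have hH0 : ∀ x, 0 ≤ H x := fun x => by simp only [hH]; have := hG0 x; positivity
  set B := univ.filter (fun y : Tor (fine n M) => P y ∧ ¬ P (y - unitVec (fine n M) μ)) with hBdef
  -- pointwise bound at a forward boundary point
  have hpt : ∀ y ∈ B, ‖(n : ℂ) * z y‖ ^ 2 ≤ (2 / (n : ℝ)) * ∑ i ∈ range n, H (y + tstep (fine n M) μ i) := by
    intro y hy
    obtain ⟨hy1, hy2⟩ := (Finset.mem_filter.mp hy).2
    have hval : (D *ᵥ z) (y - unitVec (fine n M) μ) = (n : ℂ) * z y := by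
      rw [hD, sdiff_mulVec, sub_add_cancel, hz _ hy2, sub_zero]
    rw [← hval]
    refine (trace_sq_le_fwd n M hn1 μ z y).trans (mul_le_mul_of_nonneg_left ?_ (by positivity))
    have hdvd := hP.fwd y hy1 hy2
    rw [hH]
    simp only [Finset.sum_add_distrib]
    refine add_le_add (le_of_eq (Finset.sum_congr rfl fun j _ => by rw [add_sub_right_comm])) ?_
    calc ∑ i ∈ range (n - 1), ‖(Pd *ᵥ z) (y + tstep (fine n M) μ i)‖ ^ 2
        = ∑ i ∈ range (n - 1), G (y + tstep (fine n M) μ i) := by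
          refine Finset.sum_congr rfl fun i hi => ?_
          have hi' : i < n := by have := Finset.mem_range.mp hi; omega
          simp only [hG, if_pos (hP.line_add y hy1 hdvd i hi')]
      _ ≤ ∑ i ∈ range n, G (y + tstep (fine n M) μ i) :=
          Finset.sum_le_sum_of_subset_of_nonneg (Finset.range_subset_range.mpr (Nat.sub_le n 1)) (fun i _ _ => hG0 _)
  have hsub : B ⊆ univ.filter (fun y : Tor (fine n M) => n ∣ (y μ).val) := by
    intro y hy
    obtain ⟨hy1, hy2⟩ := (Finset.mem_filter.mp hy).2
    exact Finset.mem_filter.mpr ⟨Finset.mem_univ _, hP.fwd y hy1 hy2⟩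
  have htot : ∑ x, H x = nsq (D *ᵥ z) + ∑ x ∈ univ.filter P, ‖(Pd *ᵥ z) x‖ ^ 2 := by
    rw [hH]
    simp only [Finset.sum_add_distrib]
    congr 1
    · rw [nsq]
      exact Fintype.sum_equiv (Equiv.subRight (unitVec (fine n M) μ)) _ _ (fun _ => rfl)
    · rw [Finset.sum_filter]
  calc ∑ y ∈ B, ‖(n : ℂ) * z y‖ ^ 2 ≤ ∑ y ∈ B, (2 / (n : ℝ)) * ∑ i ∈ range n, H (y + tstep (fine n M) μ i) :=
        Finset.sum_le_sum hpt
    _ = (2 / (n : ℝ)) * ∑ y ∈ B, ∑ i ∈ range n, H (y + tstep (fine n M) μ i) := by rw [Finset.mul_sum]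
    _ ≤ (2 / (n : ℝ)) * ∑ x, H x := mul_le_mul_of_nonneg_left (sum_lines_le_of_subset n M μ hsub hH0) (by positivity)
    _ = _ := by rw [htot]

/-- **SUMMED TRACE BOUND, backward boundary, aligned carrier**: for `z` vanishing off `P`,
`Σ_{y∈P, y+e_μ∉P} ‖n·z(y)‖² ≤ (2/n)·(‖∂_μz‖² + Σ_{x∈P}‖(∂_μᴴ∂_μz)(x)‖²)`. [folklore] -/
theorem trace_bwd_sum_le_of_aligned (hP : AlignedDir n M μ P) (z : Tor (fine n M) → ℂ) (hz : ∀ x, ¬ P x → z x = 0) :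
    ∑ y ∈ univ.filter (fun y : Tor (fine n M) => P y ∧ ¬ P (y + unitVec (fine n M) μ)), ‖(n : ℂ) * z y‖ ^ 2
      ≤ (2 / (n : ℝ)) * (nsq (sdiff (fine n M) (n : ℂ) μ *ᵥ z)
          + ∑ x ∈ univ.filter P, ‖(Pdir (fine n M) (n : ℂ) μ *ᵥ z) x‖ ^ 2) := by
  have hn1 : 1 ≤ n := Nat.pos_of_ne_zero (NeZero.ne n)
  have hnR : (0 : ℝ) < n := by exact_mod_cast hn1
  set D := sdiff (fine n M) (n : ℂ) μ with hD
  set Pd := Pdir (fine n M) (n : ℂ) μ with hPd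
  set G : Tor (fine n M) → ℝ := fun x => if P x then ‖(Pd *ᵥ z) x‖ ^ 2 else 0 with hG
  have hG0 : ∀ x, 0 ≤ G x := fun x => by simp only [hG]; split_ifs <;> positivity
  set H : Tor (fine n M) → ℝ := fun x => ‖(D *ᵥ z) x‖ ^ 2 + G x with hH
  have hH0 : ∀ x, 0 ≤ H x := fun x => by simp only [hH]; have := hG0 x; positivity
  set c := tstep (fine n M) μ (n - 1) with hc
  set B := univ.filter (fun y : Tor (fine n M) => P y ∧ ¬ P (y + unitVec (fine n M) μ)) with hBdef
  -- pointwise bound at a backward boundary point, the line re-read from the first-layer site `y − (n−1)e`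
  have hpt : ∀ y ∈ B, ‖(n : ℂ) * z y‖ ^ 2 ≤ (2 / (n : ℝ)) * ∑ i ∈ range n, H ((y - c) + tstep (fine n M) μ i) := by
    intro y hy
    obtain ⟨hy1, hy2⟩ := (Finset.mem_filter.mp hy).2
    have hval : ‖(D *ᵥ z) y‖ = ‖(n : ℂ) * z y‖ := by
      rw [hD, sdiff_mulVec, hz _ hy2, zero_sub, mul_neg, norm_neg]
    rw [← hval]
    refine (trace_sq_le_bwd n M hn1 μ z y).trans (mul_le_mul_of_nonneg_left ?_ (by positivity))
    have hdvd := hP.bwd y hy1 hy2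
    -- re-index `i ↦ n − 1 − i`: `y − i e = (y − c) + (n − 1 − i) e`
    have ere : ∀ i, i < n → y - tstep (fine n M) μ i = (y - c) + tstep (fine n M) μ (n - 1 - i) := by
      intro i hi
      rw [hc, sub_add, sub_right_inj, eq_sub_iff_add_eq, ← tstep_add]
      congr 1; omega
    have hreflect : ∀ (K : Tor (fine n M) → ℝ), ∑ i ∈ range n, K (y - tstep (fine n M) μ i)
        = ∑ i ∈ range n, K ((y - c) + tstep (fine n M) μ i) := by
      intro K
      rw [← Finset.sum_range_reflect (fun i => K ((y - c) + tstep (fine n M) μ i)) n]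
      refine Finset.sum_congr rfl fun i hi => ?_
      rw [ere i (Finset.mem_range.mp hi)]
    rw [hH]
    simp only [Finset.sum_add_distrib]
    rw [← hreflect (fun x => ‖(D *ᵥ z) x‖ ^ 2), ← hreflect G]
    refine add_le_add le_rfl ?_
    calc ∑ i ∈ range (n - 1), ‖(Pd *ᵥ z) (y - tstep (fine n M) μ i)‖ ^ 2
        = ∑ i ∈ range (n - 1), G (y - tstep (fine n M) μ i) := by
          refine Finset.sum_congr rfl fun i hi => ?_
          have hi' : i < n := by have := Finset.mem_range.mp hi; omega
          simp only [hG, if_pos (hP.line_sub y hy1 hdvd i hi')]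
      _ ≤ ∑ i ∈ range n, G (y - tstep (fine n M) μ i) :=
          Finset.sum_le_sum_of_subset_of_nonneg (Finset.range_subset_range.mpr (Nat.sub_le n 1)) (fun i _ _ => hG0 _)
  -- the pulled-back boundary points are distinct first-layer points
  have himg : B.image (fun y => y - c) ⊆ univ.filter (fun y : Tor (fine n M) => n ∣ (y μ).val) := by
    intro y0 hy0
    obtain ⟨y, hy, rfl⟩ := Finset.mem_image.mp hy0
    obtain ⟨hy1, hy2⟩ := (Finset.mem_filter.mp hy).2
    exact Finset.mem_filter.mpr ⟨Finset.mem_univ _, (firstLayer_of_lastLayer n M (hP.bwd y hy1 hy2)).1⟩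
  have htot : ∑ x, H x = nsq (D *ᵥ z) + ∑ x ∈ univ.filter P, ‖(Pd *ᵥ z) x‖ ^ 2 := by
    rw [hH]
    simp only [Finset.sum_add_distrib]
    congr 1
    rw [Finset.sum_filter]
  calc ∑ y ∈ B, ‖(n : ℂ) * z y‖ ^ 2 ≤ ∑ y ∈ B, (2 / (n : ℝ)) * ∑ i ∈ range n, H ((y - c) + tstep (fine n M) μ i) :=
        Finset.sum_le_sum hpt
    _ = (2 / (n : ℝ)) * ∑ y0 ∈ B.image (fun y => y - c), ∑ i ∈ range n, H (y0 + tstep (fine n M) μ i) := by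
        rw [Finset.sum_image (fun a _ b _ h => sub_left_injective h), Finset.mul_sum]
    _ ≤ (2 / (n : ℝ)) * ∑ x, H x := mul_le_mul_of_nonneg_left (sum_lines_le_of_subset n M μ himg hH0) (by positivity)
    _ = _ := by rw [htot]

end Sum

/-! ## §3 The star carrier of a component is aligned in every transverse direction -/

section Star

variable (S : Tor M → Prop) [DecidablePred S]

/-- [shape] the SITES carrying component `ν` of a star-bond field: `x` with `(x, ν)` a star bond, i.e. `x ∈ Ω ∨ x + e_ν ∈ Ω`
(`Ω = blockReg n S`) — the carrier `T_ν = Ω ∪ (Ω − e_ν)`. [folklore] -/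
def starSite (ν : Fin d) : Tor (fine n M) → Prop := fun x => starReg n M S (x, ν)

omit [DecidablePred S] in
/-- unfolding: `starSite ν x ↔ blockReg x ∨ blockReg (x + e_ν)`. [folklore] -/
theorem starSite_iff (ν : Fin d) (x : Tor (fine n M)) :
    starSite n M S ν x ↔ blockReg n M S x ∨ blockReg n M S (x + unitVec (fine n M) ν) := Iff.rfl

/-- decidability of the star-site predicate. [folklore] -/
instance decStarSite (ν : Fin d) : DecidablePred (starSite n M S ν) := fun x =>
  inferInstanceAs (Decidable (starReg n M S (x, ν)))

omit [NeZero n] hM [DecidablePred S] in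
/-- a transverse unit step and the own-direction unit step commute and do not interact with block membership in the own direction:
`blockReg (x + e_μ + e_ν) = blockReg ((x + e_ν) + e_μ)`. [folklore] -/
theorem add_comm_unitVec (μ ν : Fin d) (x : Tor (fine n M)) :
    x + unitVec (fine n M) μ + unitVec (fine n M) ν = x + unitVec (fine n M) ν + unitVec (fine n M) μ := add_right_comm _ _ _

omit [NeZero n] hM [DecidablePred S] in
/-- the same with `tstep μ i`. [folklore] -/
theorem add_tstep_add_unitVec (μ ν : Fin d) (i : ℕ) (x : Tor (fine n M)) :
    x + tstep (fine n M) μ i + unitVec (fine n M) ν = x + unitVec (fine n M) ν + tstep (fine n M) μ i := add_right_comm _ _ _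

omit [NeZero n] hM [DecidablePred S] in
/-- the same with `− tstep μ i`. [folklore] -/
theorem sub_tstep_add_unitVec (μ ν : Fin d) (i : ℕ) (x : Tor (fine n M)) :
    x - tstep (fine n M) μ i + unitVec (fine n M) ν = x + unitVec (fine n M) ν - tstep (fine n M) μ i := sub_add_eq_add_sub _ _ _

omit [NeZero n] hM [DecidablePred S] in
/-- a transverse unit step does not change the `μ`-coordinate. [folklore] -/
theorem add_unitVec_apply_of_ne {μ ν : Fin d} (h : μ ≠ ν) (x : Tor (fine n M)) : (x + unitVec (fine n M) ν) μ = x μ := by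
  rw [Pi.add_apply, unitVec, Pi.single_eq_of_ne h, add_zero]

omit [DecidablePred S] in
/-- **THE STAR CARRIER OF COMPONENT `ν` IS BLOCK-ALIGNED IN EVERY TRANSVERSE DIRECTION `μ ≠ ν`** (any region `S`, any level). [folklore] -/
theorem alignedDir_starSite {μ ν : Fin d} (hμν : μ ≠ ν) : AlignedDir n M μ (starSite n M S ν) where
  fwd := by
    intro y hy hy'
    rw [starSite_iff] at hy hy'
    push Not at hy'
    rcases hy with h | h
    · exact dvd_of_boundary_fwd n M S h hy'.1
    · have h2 : ¬ blockReg n M S (y + unitVec (fine n M) ν - unitVec (fine n M) μ) := by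
        rw [← sub_add_eq_add_sub]; exact hy'.2
      have := dvd_of_boundary_fwd n M S h h2
      rwa [add_unitVec_apply_of_ne n M hμν] at this
  line_add := by
    intro y hy hdvd i hi
    rw [starSite_iff] at hy ⊢
    rcases hy with h | h
    · exact Or.inl (blockReg_add_tstep n M S h hdvd hi)
    · right
      rw [add_tstep_add_unitVec]
      exact blockReg_add_tstep n M S h (by rwa [add_unitVec_apply_of_ne n M hμν]) hi
  bwd := by
    intro y hy hy'
    rw [starSite_iff] at hy hy'
    push Not at hy'
    rcases hy with h | h
    · exact dvd_succ_of_boundary_bwd n M S h hy'.1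
    · have h2 : ¬ blockReg n M S (y + unitVec (fine n M) ν + unitVec (fine n M) μ) := by
        rw [← add_comm_unitVec]; exact hy'.2
      have := dvd_succ_of_boundary_bwd n M S h h2
      rwa [add_unitVec_apply_of_ne n M hμν] at this
  line_sub := by
    intro y hy hdvd i hi
    rw [starSite_iff] at hy ⊢
    rcases hy with h | h
    · exact Or.inl (blockReg_sub_tstep n M S h hdvd hi)
    · right
      rw [sub_tstep_add_unitVec]
      exact blockReg_sub_tstep n M S h (by rwa [add_unitVec_apply_of_ne n M hμν]) hi

/-- **SUMMED TRACE BOUND ON THE STAR CARRIER, transverse direction, forward boundary.** [folklore] -/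
theorem trace_fwd_sum_le_starSite {μ ν : Fin d} (hμν : μ ≠ ν) (z : Tor (fine n M) → ℂ)
    (hz : ∀ x, ¬ starSite n M S ν x → z x = 0) :
    ∑ y ∈ univ.filter (fun y : Tor (fine n M) => starSite n M S ν y ∧ ¬ starSite n M S ν (y - unitVec (fine n M) μ)),
        ‖(n : ℂ) * z y‖ ^ 2
      ≤ (2 / (n : ℝ)) * (nsq (sdiff (fine n M) (n : ℂ) μ *ᵥ z)
          + ∑ x ∈ univ.filter (starSite n M S ν), ‖(Pdir (fine n M) (n : ℂ) μ *ᵥ z) x‖ ^ 2) :=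
  trace_fwd_sum_le_of_aligned (alignedDir_starSite n M S hμν) z hz

/-- **SUMMED TRACE BOUND ON THE STAR CARRIER, transverse direction, backward boundary.** [folklore] -/
theorem trace_bwd_sum_le_starSite {μ ν : Fin d} (hμν : μ ≠ ν) (z : Tor (fine n M) → ℂ)
    (hz : ∀ x, ¬ starSite n M S ν x → z x = 0) :
    ∑ y ∈ univ.filter (fun y : Tor (fine n M) => starSite n M S ν y ∧ ¬ starSite n M S ν (y + unitVec (fine n M) μ)),
        ‖(n : ℂ) * z y‖ ^ 2
      ≤ (2 / (n : ℝ)) * (nsq (sdiff (fine n M) (n : ℂ) μ *ᵥ z)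
          + ∑ x ∈ univ.filter (starSite n M S ν), ‖(Pdir (fine n M) (n : ℂ) μ *ᵥ z) x‖ ^ 2) :=
  trace_bwd_sum_le_of_aligned (alignedDir_starSite n M S hμν) z hz

/-- gan24's block-region statement is the instance `P = blockReg n S` (consistency check, forward). [folklore] -/
example (μ : Fin d) (z : Tor (fine n M) → ℂ) (hz : ∀ x, ¬ blockReg n M S x → z x = 0) :
    ∑ y ∈ univ.filter (fun y : Tor (fine n M) => blockReg n M S y ∧ ¬ blockReg n M S (y - unitVec (fine n M) μ)),
        ‖(n : ℂ) * z y‖ ^ 2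
      ≤ (2 / (n : ℝ)) * (nsq (sdiff (fine n M) (n : ℂ) μ *ᵥ z)
          + ∑ x ∈ univ.filter (blockReg n M S), ‖(Pdir (fine n M) (n : ℂ) μ *ᵥ z) x‖ ^ 2) :=
  trace_fwd_sum_le_of_aligned (alignedDir_blockReg n M S μ) z hz

end Star

end Torus

end Summit.QuantumFields.BalabanUV.T4Continuum.AlignedCarrierTrace

end
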